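import Summits.Ventures.QEC.CircuitDistance.PortK2DataBB144Z
import Summits.Ventures.QEC.CircuitDistance.K2Chunks
import HarnessLib

/-!
# K2(`[[144,12,12]]`) chunk module — COMPUTATIONAL (native_decide; `Lean.ofReduceBool`)

Cell `qec`, CDX, R146/R152 STEP 1 («computational» header; `ofReduceBool` confined to these chunk modules). Checker of record
`K2.K2Data` (qec-cdx-type-1, PortK2Check); data module of record `PortK2DataBB144X/Z` (p669158/9, crit-1 data audit PASS
2026-08-28T21:20Z); chunk glue `K2Chunks` (idea-1 g2). Cube 0, child 2: leaf group 8 of 14.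
Leaf theorems: the K2 DFS accepts below one descendant state of pivot cube 0 (sector Z); sizes are exact DFS visit counts
(eng-1 g2 `k2count.c`), capped so that the gate's native-axiom audit re-verifies every leaf in place. Assemblies re-derive the
child lists in the kernel (`decide`) and end in the literal cube fact `d144Z.cube (Ts144Z.getD 0 []) (0) (lives144Z.getD 0 0) = true`
(the `hcubes` hypothesis of `K2Inst.k2_complete`). Emitted by qec-cdx-eng-1 g2 (`gen2.py`, idea-1's `gen_k2chunks_from_lean.py` lineage).
-/

namespace Summit.Ventures.QEC.CircuitDistance.K2

set_option maxRecDepth 100000 in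
set_option maxHeartbeats 0 in
set_option exponentiation.threshold 1024 in
/-- K2(144) chunk fact `cube144Z0_ch2_9` (731207 DFS visits; see the module docstring). -/
theorem cube144Z0_ch2_9 : app5 (d144Z.dfs (Ts144Z.getD 0 []) 6) (2511081051432241103104, 1672, 11972621413014756705924586149621235229987138682486785, 3, 2348542582773833227889480596789337027375682548908319870695294780193984999010718089886346466164186906135363548) = true := by native_decide

set_option maxRecDepth 100000 in
set_option maxHeartbeats 0 in
set_option exponentiation.threshold 1024 in
/-- K2(144) chunk fact `cube144Z0_ch2_10` (920648 DFS visits; see the module docstring). -/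
theorem cube144Z0_ch2_10 : app5 (d144Z.dfs (Ts144Z.getD 0 []) 6) (149897809998609664000, 3720, 766247770432944429179173513575164036542335300382228481, 3, 2348542582773833227889480596789337027375682548908319869929047009761040569831544576311191874354817345043562460) = true := by native_decide

set_option maxRecDepth 100000 in
set_option maxHeartbeats 0 in
set_option exponentiation.threshold 1024 in
/-- K2(144) chunk fact `cube144Z0_ch2_11_0` (140102 DFS visits; see the module docstring). -/
theorem cube144Z0_ch2_11_0 : app5 (d144Z.dfs (Ts144Z.getD 0 []) 5) (20283790777647104, 32, 842498333348457493583344221469363458551160772649125926142522425345, 4, 2348542582773833227889480596789337027375681706409986521471553426416819100468086025150428669961856941811564508) = true := by native_decide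

set_option maxRecDepth 100000 in
set_option maxHeartbeats 0 in
set_option exponentiation.threshold 1024 in
/-- K2(144) chunk fact `cube144Z0_ch2_11_1` (139473 DFS visits; see the module docstring). -/
theorem cube144Z0_ch2_11_1 : app5 (d144Z.dfs (Ts144Z.getD 0 []) 5) (20336567604215808, 0, 842498333348457493583344221469363458551160772649125996511266603009, 4, 2348542582773833227889480596789337027375681706409986521471553426416819100468086025150428669961716204323209180) = true := by native_decide

set_option maxRecDepth 100000 in
set_option maxHeartbeats 0 in
set_option exponentiation.threshold 1024 in
/-- K2(144) chunk fact `cube144Z0_ch2_11_2` (168333 DFS visits; see the module docstring). -/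
theorem cube144Z0_ch2_11_2 : app5 (d144Z.dfs (Ts144Z.getD 0 []) 5) (6937795225964249088, 8, 842498333348457493583344221469363458551160772658349227810633023489, 4, 2348542582773833227889480596789337027375681706409986521471553426416819100468086025150428660738344167468433372) = true := by native_decide
end Summit.Ventures.QEC.CircuitDistance.K2
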